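import Summits.BirchSwinnertonDyer.Rank1Residual.X2.RankOneHeegner
import Summits.BirchSwinnertonDyer.Rank1Residual.X2.Cells
import Literature.NumberTheory.EllipticCurves.Rank1Residual.Typed.KolyvaginCertificate
import Literature.NumberTheory.EllipticCurves.Rank1Residual.Typed.HigherDescentCertificate
import HarnessLib

/-!
# Row B11 (X2c = `CellC`, `r_an = 1`, `p ‖ N`, `E[p]` reducible) PER PAIR, PREPRINT-FREE: `BSD(E,p)` from
# Gross–Zagier–Kolyvagin ALONE plus the finite certificate of a `p`-ISOGENY DESCENT on the rank-one curve itself —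
# `Ш(E)[p] = 0` (two isogeny Selmer groups as small as the Mordell–Weil images) and `p ∤ #Ш(E)_an`; and the layered /
# stabilised forms when `p ∣ #Ш(E)_an` (cell `bsd-eis`, seat `bsd-eis-k5-p4` g0, lens «Cassels–Tate / isogeny-descent
# decision road»; crux 4 `BSDpOnCellC` stmt-BirchSwinnertonDyer-19034 — THEOREMS ONLY, nothing booked)

HONEST FRAMING (cell `bsd-eis`, run/shared/lean/pub/bsd-eis/; ladder row B11 = 12 665 (class, p) cells of record,
12 106 @3 · 516 @5 · 43 @7). Row B11 is CONSTRUCTION-SHAPED class-wide (Keller–Yin 2024 p. 4: «provided the results in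
[CGS] are extended to higher weight modular forms») and crux 4 stays OPEN; every per-pair booking of the cell so far reads
the rank-one `p`-part THROUGH an Iwasawa-theoretic input — Keller–Yin Thm. D [PRE] on the ψ-even / twist-certificate roads
(`T-EISX2LZ`, `T-EISX2TWC`), or Disegni's non-split `p`-adic BSD + a `(μ, λ) = (0, 1)` reading on the λ-minimal road
(`T-EISX2LM1`, PRE-free, 2 060 cells). THIS FILE records the road that needs NO Iwasawa theory and NO preprint: in
analytic rank `≤ 1`, Gross–Zagier–Kolyvagin (`rank_eq_analyticRank_of_analyticRank_le_one`, bsd.S17) gives `rank E(ℚ) =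
r_an` and `Ш(E)` finite, and Miller's last clause of `BSD(E,p)` is then DECIDED by two finite reads: `ord_p #Ш(E)_an`
(rank-one `#Ш_an`: Cremona `allbsd` ‖ PARI `L'(E,1)/(ellbsd · ĥ(P))`) and the `p`-primary structure of `Ш(E)` from a
tower of descents — at the Eisenstein prime a `p`-ISOGENY descent: both isogeny Selmer groups `Sel^{φ}(E)`,
`Sel^{φ̂}(E')` (`E' = E/C`, `C` the rational kernel; `L = ℚ(C)` has degree `≤ 2` at `p = 3`) by the cell's two engines
`isogchi.gp` ‖ `isogcft.gp` (EXCESS `= dim Ш(E)[φ] + dim Ш(E')[φ̂]`; EXCESS `= 0 ⇒ Ш(E)[p] = Ш(E')[p] = 0` by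
`0 → Ш(E)[φ] → Ш(E)[p] → Ш(E')[φ̂]`), and where EXCESS `> 0` the Cassels–Tate pairing on `S^{(φ̂)}` (van Beek–Fisher
2018; `ctp3iso`) — this is the b2b referee's census wording R13.2 («PUB modulo per-curve certificate `Ш(E/ℚ)[p] = 0`»,
`Typed.bsdp_of_shaAn_unit_of_noPTorsion`) instantiated on row B11, where the rational `p`-isogeny that DEFINES the row is
exactly what makes the descent cheap.

* §1 `X2.cellC_bsdp_of_shaAn_unit_of_noPTorsion` — `CellC W p → #Ш(W)_an = q, ord_p q = 0 → Ш(W)[p] = 0 → BSDp W p`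
  (GZK only); `…_of_isIsogenous` — the two reads on ANY globally minimal `W' ∼ W` (Cassels' invariance; e.g. on
  `E' = E/C`, or on Cremona's curve #1 when the atlas record is another member); `X2.cellC_bsdp_pair_…` — both members.
* §2 `X2.cellC_bsdp_of_stable` — `p ∣ #Ш(W)_an`: the native higher-descent certificate `Ш[p^{k+1}] = Ш[p^k]`,
  `#Ш[p^k] = p^m`, `ord_p #Ш_an = m` (`Typed.bsdp_of_stable`; at `k = 1`, `m = 2`: `Ш[p] ≅ (ℤ/p)²` from the first descent
  and `Ш[p²] = Ш[p]` = "Cassels–Tate non-degenerate on `Ш[p]`" from `ctp3iso`), + the isogenous form.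
* §3 the DECISION: under the §2 reads `BSDp W p ↔ ord_p #Ш(W)_an = m` — a cell whose two reads disagree is a
  counterexample to BSD, never «no road» (none observed; nothing claimed).

What this is NOT: not a class theorem (crux 4 / Keller–Yin Thm. D remain the class-wide inputs); not a count move (the
planner files, referee B prices — precedent: b2b R13.2 / C39, bsd-eis R723 `T-EISX2LM1`); the certificate bits are
instrument READS (two engines per bit), nothing is evaluated here; `r_an = 1` is the row's census datum inside `CellC`.

References: [Miller2011LMS] §1, Def. 1.1; [SilvermanAEC2009] Thm. X.4.2; [MilneADT2006] Thm. I.7.3 (Cassels);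
Gross–Zagier 1986 / Kolyvagin 1990 (bsd.S17); Schaefer, J. Number Theory 56 (1996) L. 3.8; Schaefer–Stoll, Trans. AMS 356
(2004); Miller–Stoll, Math. Comp. 82 (2013) (explicit isogeny descent); van Beek–Fisher, Acta Arith. 185 (2018);
tree `Typed/KolyvaginCertificate.lean`, `Typed/HigherDescentCertificate.lean`, `Rank1Residual/X1ThreeDescentCertificate.lean`
(the X1 rank-one twin, b2b prover B gen 5).
-/

set_option autoImplicit false
set_option linter.dupNamespace false

noncomputable section

open scoped Classical

open WeierstrassCurve Literature.NumberTheory.EllipticCurves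
  Literature.NumberTheory.EllipticCurves.ModularForms
  Literature.NumberTheory.EllipticCurves.Rank1Residual
  Literature.NumberTheory.EllipticCurves.Rank1Residual.Typed
  Summit.BirchSwinnertonDyer.Rank1Residual

namespace Summit.BirchSwinnertonDyer.BirchSwinnertonDyer.Theorems.B11DescentCertificate

variable (W : WeierstrassCurve ℚ) [W.IsElliptic] [W.IsGloballyMinimal] (p : ℕ) [Fact p.Prime]

/-! ### §1 `p ∤ #Ш(E)_an`: GZK + `Ш(E)[p] = 0` -/

omit [W.IsGloballyMinimal] in
/-- **Row B11 per pair, preprint-free: `CellC W p → ord_p #Ш(W)_an = 0 → Ш(W)[p] = 0 → BSDp W p`.** The only named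
fact is Gross–Zagier–Kolyvagin (`hGZK`: `rank = r_an = 1`, `Ш` finite); `hq`/`hv` READ the rank-one analytic order of
`Ш` (two engines), `h` READS the `p`-isogeny descent (EXCESS `= 0` on both engines, or first descent + Cassels–Tate bit).
The lever is `Typed.bsdp_of_shaAn_unit_of_noPTorsion`; the class hypothesis only fixes the census shape. Per pair; NOT a
class theorem. [cite: Miller2011LMS, §1 and Def. 1.1] -/
theorem X2.cellC_bsdp_of_shaAn_unit_of_noPTorsion (hGZK : rank_eq_analyticRank_of_analyticRank_le_one)
    (hc : X2.CellC W p) {q : ℚ} (hq : shaAn W = (q : ℂ)) (hv : padicValRat p q = 0)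
    (h : ∀ x : W.sha, (p : ℤ) • x = 0 → x = 0) : BSDp W p :=
  bsdp_of_shaAn_unit_of_noPTorsion W p hGZK (by rw [hc.1]) hq hv h

/-- **The two reads on an ISOGENOUS curve** (`W ∼ W'` over `ℚ`, both globally minimal; e.g. `W' = E/C`, or Cremona's
curve #1 of the class): `ord_p #Ш(W')_an = 0` and `Ш(W')[p] = 0` give `BSDp W' p` by GZK (`r_an(W') = r_an(W) = 1`) and
`BSDp W p` by Cassels' isogeny invariance (`hCassels`, `X2.bsdp_of_isIsogenous_of_bsdp`; `L'(W',1) ≠ 0` by modularity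
`hmod`). Per pair; nothing booked. [cite: MilneADT2006, Thm. I.7.3] [cite: Miller2011LMS, §1 and Def. 1.1] -/
theorem X2.cellC_bsdp_of_shaAn_unit_of_noPTorsion_of_isIsogenous
    (hGZK : rank_eq_analyticRank_of_analyticRank_le_one) (hmod : hasEntireLFunction_rat)
    (hCassels : bsdRHS_eq_of_isIsogenous) (hc : X2.CellC W p)
    (W' : WeierstrassCurve ℚ) [W'.IsElliptic] [W'.IsGloballyMinimal] (hiso : IsIsogenous W W')
    {q' : ℚ} (hq' : shaAn W' = (q' : ℂ)) (hv' : padicValRat p q' = 0)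
    (h' : ∀ x : W'.sha, (p : ℤ) • x = 0 → x = 0) : BSDp W p := by
  have hr' : W'.analyticRank ≤ 1 := by rw [← analyticRank_eq_of_isIsogenous' hiso, hc.1]
  exact X2.bsdp_of_isIsogenous_of_bsdp hCassels hGZK hmod W' W hiso.symm_of_charZero p hr'
    (bsdp_of_shaAn_unit_of_noPTorsion W' p hGZK hr' hq' hv' h')

/-- **Both members at once** (census shape `E —φ→ E'`): the reads on `W'` give `BSDp W p ∧ BSDp W' p`.
[cite: MilneADT2006, Thm. I.7.3] [cite: Miller2011LMS, §1 and Def. 1.1] -/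
theorem X2.cellC_bsdp_pair_of_shaAn_unit_of_noPTorsion
    (hGZK : rank_eq_analyticRank_of_analyticRank_le_one) (hmod : hasEntireLFunction_rat)
    (hCassels : bsdRHS_eq_of_isIsogenous) (hc : X2.CellC W p)
    (W' : WeierstrassCurve ℚ) [W'.IsElliptic] [W'.IsGloballyMinimal] (hiso : IsIsogenous W W')
    {q' : ℚ} (hq' : shaAn W' = (q' : ℂ)) (hv' : padicValRat p q' = 0)
    (h' : ∀ x : W'.sha, (p : ℤ) • x = 0 → x = 0) : BSDp W p ∧ BSDp W' p := by
  have hr' : W'.analyticRank ≤ 1 := by rw [← analyticRank_eq_of_isIsogenous' hiso, hc.1]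
  exact ⟨X2.cellC_bsdp_of_shaAn_unit_of_noPTorsion_of_isIsogenous W p hGZK hmod hCassels hc W' hiso hq' hv' h',
    bsdp_of_shaAn_unit_of_noPTorsion W' p hGZK hr' hq' hv' h'⟩

/-! ### §2 `p ∣ #Ш(E)_an`: GZK + the stabilised descent count -/

omit [W.IsGloballyMinimal] in
/-- **Row B11 per pair with `p ∣ #Ш(E)_an`, preprint-free:** `CellC W p`, the native higher-descent certificate
`Ш(W)[p^{k+1}] = Ш(W)[p^k]` (`hstab`), `#Ш(W)[p^k] = p^m` (`hcard`) and `ord_p #Ш(W)_an = m` give `BSDp W p`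
(`Typed.bsdp_of_stable`, GZK only). At `k = 1`, `m = 2`: `Ш[p] ≅ (ℤ/p)²` by the first `p`-isogeny descent (EXCESS `= 2`,
both classes on one side, Mordell–Weil images exact) and `Ш[p²] = Ш[p]` = the Cassels–Tate pairing on `Ш[p]` is
NON-degenerate (van Beek–Fisher / `ctp3iso` verdict NONDEG). Per pair; NOT a class theorem.
[cite: SilvermanAEC2009, Thm. X.4.2] [cite: Miller2011LMS, §1 and Def. 1.1] -/
theorem X2.cellC_bsdp_of_stable (hGZK : rank_eq_analyticRank_of_analyticRank_le_one)
    (hc : X2.CellC W p) {k m : ℕ}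
    (hstab : ∀ x : W.sha, p ^ (k + 1) • x = 0 → p ^ k • x = 0)
    (hcard : Nat.card (AddSubgroup.torsionBy W.sha (p ^ k : ℕ)) = p ^ m)
    {q : ℚ} (hq : shaAn W = (q : ℂ)) (hv : padicValRat p q = m) : BSDp W p :=
  bsdp_of_stable W p hGZK (by rw [hc.1]) hstab hcard hq hv

/-- **The stabilised reads on an ISOGENOUS curve** `W' ∼ W`: `BSDp W' p` by `Typed.bsdp_of_stable`, moved to `W` by
Cassels. [cite: MilneADT2006, Thm. I.7.3] [cite: SilvermanAEC2009, Thm. X.4.2] [cite: Miller2011LMS, §1 and Def. 1.1] -/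
theorem X2.cellC_bsdp_of_stable_of_isIsogenous
    (hGZK : rank_eq_analyticRank_of_analyticRank_le_one) (hmod : hasEntireLFunction_rat)
    (hCassels : bsdRHS_eq_of_isIsogenous) (hc : X2.CellC W p)
    (W' : WeierstrassCurve ℚ) [W'.IsElliptic] [W'.IsGloballyMinimal] (hiso : IsIsogenous W W') {k m : ℕ}
    (hstab' : ∀ x : W'.sha, p ^ (k + 1) • x = 0 → p ^ k • x = 0)
    (hcard' : Nat.card (AddSubgroup.torsionBy W'.sha (p ^ k : ℕ)) = p ^ m)
    {q' : ℚ} (hq' : shaAn W' = (q' : ℂ)) (hv' : padicValRat p q' = m) : BSDp W p := by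
  have hr' : W'.analyticRank ≤ 1 := by rw [← analyticRank_eq_of_isIsogenous' hiso, hc.1]
  exact X2.bsdp_of_isIsogenous_of_bsdp hCassels hGZK hmod W' W hiso.symm_of_charZero p hr'
    (bsdp_of_stable W' p hGZK hr' hstab' hcard' hq' hv')

/-! ### §3 The decision: the two reads settle `BSD(E,p)` either way -/

omit [W.IsGloballyMinimal] in
/-- **DECISION on row B11:** under `CellC W p` and the stabilised descent reads (`hstab`, `hcard`), `BSD(E,p)` holds IF AND
ONLY IF `ord_p #Ш(W)_an = m` (⇐ `Typed.bsdp_of_stable`; ⇒ Miller's clause read backwards, `Ш` finite by GZK: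
`Typed.missingPPartAt_of_bsdp` + `Typed.padicValNat_shaOrder_eq_of_stable`). The special case `k = 0`, `m = 0` (`Ш[p] = 0`):
`BSDp W p ↔ ord_p #Ш(W)_an = 0`. [cite: SilvermanAEC2009, Thm. X.4.2] [cite: Miller2011LMS, §1 and Def. 1.1] -/
theorem X2.cellC_bsdp_iff_padicValRat_shaAn_eq_of_stable (hGZK : rank_eq_analyticRank_of_analyticRank_le_one)
    (hc : X2.CellC W p) {k m : ℕ}
    (hstab : ∀ x : W.sha, p ^ (k + 1) • x = 0 → p ^ k • x = 0)
    (hcard : Nat.card (AddSubgroup.torsionBy W.sha (p ^ k : ℕ)) = p ^ m)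
    {q : ℚ} (hq : shaAn W = (q : ℂ)) : BSDp W p ↔ padicValRat p q = m := by
  have hr : W.analyticRank ≤ 1 := by rw [hc.1]
  refine ⟨fun h ↦ ?_, fun hv ↦ bsdp_of_stable W p hGZK hr hstab hcard hq hv⟩
  haveI : Finite W.sha := (hGZK W hr).2
  obtain ⟨q₀, hq₀, hv₀⟩ := missingPPartAt_of_bsdp W p h
  have hqq : q₀ = q := by exact_mod_cast hq₀.symm.trans hq
  subst hqq
  rw [hv₀, padicValNat_shaOrder_eq_of_stable W p (hGZK W hr).2 hstab hcard]

omit [W.IsGloballyMinimal] in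
/-- **DECISION, unit case:** under `CellC W p` and the read `Ш(W)[p] = 0`, `BSDp W p ↔ ord_p #Ш(W)_an = 0`
(`Typed.missingPPartAt_iff_noPTorsion_of_shaAn_unit` gives ⇐; ⇒ as above with `Typed.padicValNat_shaOrder_eq_zero_of_noPTorsion`).
[cite: Miller2011LMS, §1 and Def. 1.1] -/
theorem X2.cellC_bsdp_iff_padicValRat_shaAn_eq_zero_of_noPTorsion
    (hGZK : rank_eq_analyticRank_of_analyticRank_le_one) (hc : X2.CellC W p)
    (h : ∀ x : W.sha, (p : ℤ) • x = 0 → x = 0) {q : ℚ} (hq : shaAn W = (q : ℂ)) :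
    BSDp W p ↔ padicValRat p q = 0 := by
  have hr : W.analyticRank ≤ 1 := by rw [hc.1]
  refine ⟨fun hB ↦ ?_, fun hv ↦ bsdp_of_shaAn_unit_of_noPTorsion W p hGZK hr hq hv h⟩
  haveI : Finite W.sha := (hGZK W hr).2
  obtain ⟨q₀, hq₀, hv₀⟩ := missingPPartAt_of_bsdp W p hB
  have hqq : q₀ = q := by exact_mod_cast hq₀.symm.trans hq
  subst hqq
  rw [hv₀, padicValNat_shaOrder_eq_zero_of_noPTorsion W p (hGZK W hr).2 h]
  rfl

end Summit.BirchSwinnertonDyer.BirchSwinnertonDyer.Theorems.B11DescentCertificate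

end
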